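import Mathlib

/-!
# R31 «THE HOST LAW» — kernel companion (vertex Euclid walks at isolated 𝔾ₘ-fixed residue points: wall pairs, FREE-legality, host-legality)

OURS · L1 W4.5b · IDEATOR 1 (res-L1-w45b-idea-1 gen 39) · crux EL♮(3) = stmt-ResolutionOfSingularities-20148 · counted 0 ·
EL♮(3) is NOT proved here or anywhere in this file · AI-written, weaker than expert review · nothing below is attributed to [Hironaka2017].

THE OBJECTS (memo `R31-HOST-LAW.md` §1–§2).  At an isolated 𝔾ₘ-fixed residue point `q′` with regular local coordinates `(x₁,x₂,x₃)` and POSITIVE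
local weights `w = (w₁,w₂,w₃)` (R30's `q′` has `w = (a−1,1,1)`), the VERTEX EUCLID WALK (R26 LEMMA E, R30 §4(λ)) is the toric word which stars,
at every step, the cone of the running fan `Σ` (initially the orthant) that carries `w` in its relative interior: a 3-cone = a POINT step, a 2-cone
`⟨v,u⟩` = a CURVE step with centre the complete torus curve `Γ = V(⟨v,u⟩) = St D_v ∩ D_u`; it ENDS when `w` is a ray.  Here `u` is always the ray
created at the previous step and `v` («the old ray») a ray of the previous carrier.  The WALL PAIR of a curve step is
`(n_v, n_u) := (D_v·Γ, D_u·Γ) = ((Γ²)_{D_u}, (Γ²)_{St D_v})`, so that `N_{Γ} ≅ 𝒪(n_v) ⊕ 𝒪(n_u)` with `N_{Γ/D_u} = 𝒪(n_v)`, `N_{Γ/St D_v} = 𝒪(n_u)`.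
THREE FACTS give the dynamics (memo §2): (F1) after a point step at `p ∈ D_v`, `Γ = St D_v ∩ E_p` is a line of `E_p ≅ ℙ²` and the exceptional
curve of `Bl_p D_v`: pair `(1, −1)`; (F2) after a curve step at `C = D_v ∩ D_{v″}` with pair `(c, c′) = (n_v(C), n_{v″}(C))`, the next centre is
`Γ = St D_s ∩ E_C` for the SURVIVOR `s ∈ {v, v″}` (the ray with the larger coefficient of `w`), and `(Γ²)_{St D_s} = (C²)_{D_s}` (a Cartier centre on
`D_s` does not change `D_s`), while (F3) `Γ ⊂ E_C = ℙ(N_C)` is the section of the sub-line-bundle `L = N_{C/D_s}`, of self-intersection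
`deg N_C − 2·deg L`.  Hence the pair moves by `keepOld : (p,q) ↦ (p − q, q)` (survivor `v`) or `keepNew : (p,q) ↦ (q − p, p)` (survivor `v″`),
starting from `plane = (1, −1)`; which move fires is decided by the subtractive Euclidean algorithm on the two coefficients of `w` (§1b).
DOOR DICTIONARY (R27 §1 reading of blob₂, unchanged): the Q-level FREE letter (iii) needs `DirStepUnobs F univ Γ`, i.e. `H¹(N_Γ) = 0`, i.e.
`min(n_v,n_u) ≥ −1` («FREE-legal»); a HOSTED line round with host `D ∈ {St D_v, D_u}` needs `H¹(N_{Γ/D}) = 0`, i.e. `(Γ²)_D ≥ −1`, available iff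
`max(n_v,n_u) ≥ −1` («host-legal»).
WHAT THIS FILE CERTIFIES (kernel; `decide` / `omega` / `ring` only): §1 THE WALL GAME — every pair reachable from `(1,−1)` by the two moves has
`max ≥ 1` (`plane_legal`, `keepOld_legal`, `keepNew_legal`: EVERY curve step of EVERY vertex Euclid walk is host-legal, with a host of self-intersection `≥ 1`), pairs with
arbitrarily negative `min` occur (`turn_pair`: the first TURN of the Euclidean algorithm is FREE-illegal), the computable walk `wallsOf`
(coefficient model, cross-checked against the fan engine `r31/euclid_walls.py` on all `w ∈ [1,12]³`, 0 mismatches) produces only host-legal pairs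
(`wallsOf_legal`), the instances `w = (3,2,2)` (FIRST FREE-illegal vertex weight: pairs `(1,−1), (−2,1)`), `(5,2,2)`, and R30's family `(a−1,1,1)`,
`a = 3,4,5,6` (pairs `(j,−1)`, `j = 1..a−2` = R30 §4(λ) `N_{λ_j} = 𝒪(−1) ⊕ 𝒪(j)`), and the CENSUS on the box `[1,8]³` (512 weights, 1 065 curve
steps, 186 FREE-illegal steps on 93 weights, 0 host-illegal); §2 the arithmetic of (F1)–(F3) and of the `(3,2,2)` fan (unimodular cones, wall
relation); §3 the R29 LAW B re-read for the hosted specimens `S-(a,a+1,2a+1)` (all `a`): in the Z^st-first order the line `ℓ^st` has pair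
`((ℓ^st)²_{St Q″}, (ℓ^st)²_{St E_P}) = (−1, 1−a)`, FREE-illegal for `a ≥ 3` (= R29-B, `h¹ = a−2`) but host-legal (host `St Q″`), and the adapted
coordinates in which `ℓ^st = St E_P ∩ St Q″` is a transversal complete intersection `V(X + y₁^a, V₁)` (symbolic `a`).
WHAT IT DOES NOT CERTIFY: the geometric facts (F1)–(F3) themselves (standard intersection theory on blow-ups / ruled surfaces, memo §2 with
sources), the boundary-supplier proposition R31-C (memo §4), any singular-locus statement (kit job of ROUND 31).
-/

set_option linter.style.longLine false
set_option linter.unusedVariables false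
set_option linter.dupNamespace false
set_option maxRecDepth 8000

namespace Summit.ResolutionOfSingularities.ResolutionOfSingularities.Cruxes.EquisingularLiftNatThree.GmNosesHostLawR31

/-! ## §1 The wall game -/

/-- **THEOREM R31-A (HOST LAW), the induction in three lines.**  The wall pairs `(n_old, n_new)` of the curve steps of a vertex Euclid walk start
at the PLANE PAIR `(1, −1)` (fact (F1): a line in the fresh exceptional plane, `(Γ²)_{E_p} = 1`, `(Γ²)_{St D_v} = −1`) and move by
`keepOld : (p,q) ↦ (p − q, q)` / `keepNew : (p,q) ↦ (q − p, p)` (facts (F2), (F3)); the invariant `max ≥ 1` holds at the start and is preserved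
by both moves.  Hence EVERY curve step is host-legal, with a host of self-intersection `≥ 1`. -/
theorem plane_legal : (1 : ℤ) ≤ max 1 (-1) := by norm_num

theorem keepOld_legal (p q : ℤ) (h : 1 ≤ max p q) : 1 ≤ max (p - q) q := by
  simp only [le_max_iff] at h ⊢; omega

theorem keepNew_legal (p q : ℤ) (h : 1 ≤ max p q) : 1 ≤ max (q - p) p := by
  simp only [le_max_iff] at h ⊢; omega

/-- bookkeeping: the coordinate sum of the new pair is the survivor's old coordinate (`deg N_Γ = (C²)_{D_s}`). -/
theorem sum_moves (p q : ℤ) : (p - q) + q = p ∧ (q - p) + p = q := by constructor <;> ring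

/-- a `keepOld` RUN from the plane pair: `(1,−1) ↦ (2,−1) ↦ … ↦ (m+1,−1)` — R30's toric tower `λ_1, …, λ_{a−2}` over `q′` (`w = (a−1,1,1)`,
walls `N_{λ_j} = 𝒪(−1) ⊕ 𝒪(j)`): FREE-legal throughout (`min = −1`). -/
theorem run_pair (m : ℕ) : ((m : ℤ) + 1) - (-1) = (m : ℤ) + 2 ∧ (-1 : ℤ) ≤ min ((m : ℤ) + 1) (-1) ∧ (1 : ℤ) ≤ max ((m : ℤ) + 1) (-1) := by
  refine ⟨by ring, ?_, ?_⟩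
  · simp only [le_min_iff]; constructor <;> omega
  · simp only [le_max_iff]; left; omega

/-- **LAW R31-B (the first TURN is FREE-illegal).**  A `keepNew` step after a run of length `m` gives `(−1 − (m+1), m+1) = (−(m+2), m+1)`:
`min ≤ −2`, so the Q-level FREE letter (iii) (`H¹(N_Γ) = 0 ⟺ min ≥ −1`) is unavailable there, while `max = m+1 ≥ 1` (host-legal).  `m = 0` is
the vertex weight `(3,2,2)` (pairs `(1,−1), (−2,1)`), `m = 1` is `(5,2,2)`, `m = 2` is `(7,2,2)` (`instances`). -/
theorem turn_pair (m : ℕ) :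
    (-1 : ℤ) - ((m : ℤ) + 1) = -((m : ℤ) + 2) ∧
    min (-((m : ℤ) + 2)) ((m : ℤ) + 1) < -1 ∧ (1 : ℤ) ≤ max (-((m : ℤ) + 2)) ((m : ℤ) + 1) := by
  refine ⟨by ring, ?_, ?_⟩
  · simp only [min_lt_iff]; left; omega
  · simp only [le_max_iff]; right; omega

/-! ### §1b The computable walk (coefficient model) -/

/-- CURVE PHASE.  State: the coefficients `(α, β)` of `w` on (old ray, new ray) of the 2-cone carrier and the current wall pair `(p,q)`; the
carrier is starred (emitting `(p,q)`), then the subtractive Euclidean step decides the survivor: `β < α` keeps the old ray (`keepOld`), `α < β`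
keeps the new ray (`keepNew`), `α = β` ends the walk (`w` has become a ray).  `fuel ≥ α + β` suffices. -/
def curveWalls : ℕ → ℕ → ℕ → ℤ → ℤ → List (ℤ × ℤ)
  | 0, _, _, _, _ => []
  | fuel + 1, α, β, p, q =>
      if α = 0 ∨ β = 0 then [] else
        (p, q) :: (if α = β then [] else if β < α then curveWalls fuel (α - β) β (p - q) q else curveWalls fuel (β - α) α (q - p) p)

/-- POINT PHASE.  Coefficients `(c₁,c₂,c₃)` of `w` on the 3-cone carrier (initially `w` itself on the orthant): a point step replaces them by
`(m, cᵢ − m, cⱼ − m)` (`m` the minimum, zeros dropped); a unique minimum gives another point step, a double tie enters the curve phase with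
`(α, β) = (c_max − m, m)` (returned as `some (α, β)`), a triple tie ends the walk with no curve step (`none`); `none` also for non-positive weights. -/
def entry : ℕ → ℕ → ℕ → ℕ → Option (ℕ × ℕ)
  | 0, _, _, _ => none
  | fuel + 1, c₁, c₂, c₃ =>
      if c₁ = 0 ∨ c₂ = 0 ∨ c₃ = 0 then none else
        let m := min c₁ (min c₂ c₃)
        let ds := [c₁ - m, c₂ - m, c₃ - m].filter (· ≠ 0)
        match ds with
        | [] => none
        | [α] => some (α, m)
        | [d, d'] => entry fuel m d d'
        | _ => none

/-- number of point steps of the point phase (for the word length; `0` for non-positive weights). -/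
def pointSteps : ℕ → ℕ → ℕ → ℕ → ℕ
  | 0, _, _, _ => 0
  | fuel + 1, c₁, c₂, c₃ =>
      if c₁ = 0 ∨ c₂ = 0 ∨ c₃ = 0 then 0 else
        let m := min c₁ (min c₂ c₃)
        let ds := [c₁ - m, c₂ - m, c₃ - m].filter (· ≠ 0)
        match ds with
        | [d, d'] => pointSteps fuel m d d' + 1
        | _ => 1

/-- the wall pairs of the curve steps of the vertex Euclid walk of `w = (w₁,w₂,w₃)`. -/
def wallsOf (w : ℕ × ℕ × ℕ) : List (ℤ × ℤ) :=
  match entry (w.1 + w.2.1 + w.2.2 + 1) w.1 w.2.1 w.2.2 with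
  | none => []
  | some (α, β) => curveWalls (α + β + 1) α β 1 (-1)

/-- «some curve step is FREE-illegal» (`min < −1`: the Q-level letter (iii) is unavailable there). -/
def freeIllegal (l : List (ℤ × ℤ)) : Bool := l.any fun pq => decide (min pq.1 pq.2 < -1)
/-- «some curve step is host-illegal» (`max < −1`: no hosted line round either) — never happens (`wallsOf_legal`, census below). -/
def hostIllegal (l : List (ℤ × ℤ)) : Bool := l.any fun pq => decide (max pq.1 pq.2 < -1)
/-- number of FREE-illegal curve steps. -/
def freeIllegalSteps (l : List (ℤ × ℤ)) : ℕ := l.countP fun pq => decide (min pq.1 pq.2 < -1)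

/-- the curve phase preserves the invariant `max ≥ 1` (THEOREM R31-A applied along the computable walk). -/
theorem curveWalls_legal : ∀ (fuel α β : ℕ) (p q : ℤ), 1 ≤ max p q → ∀ x ∈ curveWalls fuel α β p q, 1 ≤ max x.1 x.2 := by
  intro fuel
  induction fuel with
  | zero => intro α β p q h x hx; simp [curveWalls] at hx
  | succ n ih =>
      intro α β p q h x hx
      simp only [curveWalls] at hx
      split_ifs at hx with h0 h1 h2
      · simp at hx
      · simp at hx; subst hx; exact h
      · rcases List.mem_cons.mp hx with rfl | hx'
        · exact h
        · exact ih _ _ _ _ (keepOld_legal p q h) x hx'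
      · rcases List.mem_cons.mp hx with rfl | hx'
        · exact h
        · exact ih _ _ _ _ (keepNew_legal p q h) x hx'

/-- **every curve step of every vertex Euclid walk is host-legal.** -/
theorem wallsOf_legal (w : ℕ × ℕ × ℕ) : ∀ x ∈ wallsOf w, 1 ≤ max x.1 x.2 := by
  intro x hx
  unfold wallsOf at hx
  split at hx
  · simp at hx
  · exact curveWalls_legal _ _ _ _ _ plane_legal x hx

/-- INSTANCES.  `(3,2,2)`: one point step, then the line in the fresh plane `(1,−1)`, then the TURN `(−2,1)` (FREE-illegal, host `St E_{q′}`
with `Γ² = 1`); `(5,2,2)`: `(1,−1), (2,−1)`, turn `(−3,2)`; R30's `q′` (`w = (a−1,1,1)`): `a−2` FREE-legal line rounds `(j,−1)`; `(7,2,2)`: run of two, turn `(−4,3)`; `(7,5,5)` (THE CUSTOMER of memo §6: `x⁵w² + y⁷ + z⁷` resp. `x⁵w² + y⁷ + y²z⁵` at `P₀`, kit C1–C8):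
one point step, the plane pair `(1,−1)` (`Γ₁`, transversal type `A₄`), then the IMMEDIATE TURN `(−2,1)` (`Γ₂ = E_{Γ₁} ∩ St E_{P₀}`, transversal type `A₂`,
FORCED: `Sing = Γ₂`), then `(−3,1)`, `(4,−3)` (not needed: the strict transform is regular after `Γ₂`); `(4,3,3)`: `(1,−1), (−2,1), (−3,1)`; `(7,5,3)`: four
point steps and no curve step; `(1,1,1)`: one point step, nothing else. -/
theorem instances :
    wallsOf (3,2,2) = [(1,-1), (-2,1)] ∧ pointSteps 8 3 2 2 = 1 ∧ freeIllegal (wallsOf (3,2,2)) = true ∧ hostIllegal (wallsOf (3,2,2)) = false ∧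
    wallsOf (5,2,2) = [(1,-1), (2,-1), (-3,2)] ∧
    wallsOf (2,1,1) = [(1,-1)] ∧ wallsOf (3,1,1) = [(1,-1), (2,-1)] ∧ wallsOf (4,1,1) = [(1,-1), (2,-1), (3,-1)] ∧
    wallsOf (5,1,1) = [(1,-1), (2,-1), (3,-1), (4,-1)] ∧ freeIllegal (wallsOf (5,1,1)) = false ∧
    wallsOf (7,2,2) = [(1,-1), (2,-1), (3,-1), (-4,3)] ∧
    wallsOf (7,5,5) = [(1,-1), (-2,1), (-3,1), (4,-3)] ∧ pointSteps 18 7 5 5 = 1 ∧ wallsOf (4,3,3) = [(1,-1), (-2,1), (-3,1)] ∧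
    wallsOf (7,5,3) = [] ∧ pointSteps 16 7 5 3 = 4 ∧ wallsOf (1,1,1) = [] ∧ pointSteps 4 1 1 1 = 1 := by
  decide

/-- smallest FREE-illegal vertex weights: in the box `[1,3]³` exactly the three permutations of `(3,2,2)` have a FREE-illegal step. -/
theorem first_illegal :
    ((List.range 3).flatMap fun i => (List.range 3).flatMap fun j => (List.range 3).filterMap fun k =>
      if freeIllegal (wallsOf (i+1, j+1, k+1)) then some (i+1, j+1, k+1) else none) = [(2,2,3), (2,3,2), (3,2,2)] := by
  decide

/-- the box `[1,n]³` of vertex weights. -/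
def box (n : ℕ) : List (ℕ × ℕ × ℕ) :=
  (List.range n).flatMap fun i => (List.range n).flatMap fun j => (List.range n).map fun k => (i+1, j+1, k+1)

/-- **CENSUS (kernel) on `[1,6]³`**: 216 weights, 345 curve steps, 51 FREE-illegal steps on 30 weights, 0 host-illegal weights
(python fan engine `r31/euclid_walls.py` and the coefficient model agree; `[1,8]³` next; the primitive weights with `max wᵢ ≤ 16` in the memo). -/
theorem census6 :
    (box 6).length = 216 ∧ ((box 6).map fun w => (wallsOf w).length).sum = 345 ∧
    ((box 6).map fun w => freeIllegalSteps (wallsOf w)).sum = 51 ∧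
    ((box 6).filter fun w => freeIllegal (wallsOf w)).length = 30 ∧
    ((box 6).filter fun w => hostIllegal (wallsOf w)).length = 0 := by
  decide

/-- **CENSUS (kernel) on `[1,8]³`**: 512 weights, 1 065 curve steps, 186 FREE-illegal steps on 93 weights, 0 host-illegal weights. -/
theorem census8 :
    (box 8).length = 512 ∧ ((box 8).map fun w => (wallsOf w).length).sum = 1065 ∧
    ((box 8).map fun w => freeIllegalSteps (wallsOf w)).sum = 186 ∧
    ((box 8).filter fun w => freeIllegal (wallsOf w)).length = 93 ∧
    ((box 8).filter fun w => hostIllegal (wallsOf w)).length = 0 := by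
  decide

/-! ## §2 The arithmetic of the three facts and of the `(3,2,2)` fan -/

/-- (F3) the section of `ℙ(N)` given by a sub-line-bundle `L ⊂ N` (`rk N = 2`) has normal bundle `L^∨ ⊗ N/L`, degree `deg N − 2 deg L`; with
`deg N = c + c′` and `deg L = (C²)_{D_s} = c′` this is `c − c′` — the first coordinate of `keepOld`. (F2): the other coordinate stays `c′`. -/
theorem ruled_section (c c' : ℤ) : (c + c') - 2 * c' = c - c' ∧ (c + c') - c' - c' = c - c' := by constructor <;> ring

/-- (F1) the plane pair: a line `Γ ⊂ E_p ≅ ℙ²` has `Γ² = 1` there and is the `(−1)`-curve of `Bl_p D_v`; `deg N_Γ = 0 = (−K)·Γ − 2` with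
`(−K_{Bl_p})·Γ = 2·1`. -/
theorem plane_pair : (1 : ℤ) + (-1) = 0 ∧ (2 : ℤ) * 1 - 2 = 0 := by norm_num

/-- the `(3,2,2)` fan: rays `e₁=(1,0,0)`, `e₂=(0,1,0)`, `e₃=(0,0,1)`, `u₁=(1,1,1)` (point step), `u₂=u₁+e₁=(2,1,1)` (line `V(⟨e₁,u₁⟩)`),
`w=u₁+u₂=(3,2,2)` (curve `Γ₂ = V(⟨u₁,u₂⟩)`, END).  Coefficients: `w = 2u₁ + 1·e₁` (carrier `⟨u₁,e₁⟩` after the point step), `w = u₁ + u₂`.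
The two maximal cones at `⟨u₁,u₂⟩` are `⟨u₁,u₂,e₂⟩`, `⟨u₁,u₂,e₃⟩`, both unimodular, with wall relation `e₂ + e₃ + (−2)·u₁ + 1·u₂ = 0`: `N_{Γ₂} ≅
𝒪(−2) ⊕ 𝒪(1)` — `(Γ₂²)_{E_{Γ₁}} = −2` (the negative section of `𝔽₂… of ℙ(𝒪(1)⊕𝒪(−1))`), `(Γ₂²)_{St E_{q′}} = +1` (a line of the plane). -/
theorem fan322 :
    ((3:ℤ), (2:ℤ), (2:ℤ)) = (2*1 + 1*1, 2*1 + 1*0, 2*1 + 1*0) ∧ ((3:ℤ), (2:ℤ), (2:ℤ)) = (1 + 2, 1 + 1, 1 + 1) ∧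
    -- det ⟨u₁,u₂,e₂⟩ = |1 1 1; 2 1 1; 0 1 0| and det ⟨u₁,u₂,e₃⟩ = |1 1 1; 2 1 1; 0 0 1|
    (1*(1*0 - 1*1) - 1*(2*0 - 1*0) + 1*(2*1 - 1*0) : ℤ) = 1 ∧ (1*(1*1 - 1*0) - 1*(2*1 - 1*0) + 1*(2*0 - 1*0) : ℤ) = -1 ∧
    -- wall relation, componentwise: e₂ + e₃ − 2u₁ + u₂ = 0
    ((0:ℤ) + 0 - 2*1 + 2, (1:ℤ) + 0 - 2*1 + 1, (0:ℤ) + 1 - 2*1 + 1) = (0, 0, 0) ∧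
    min (-2 : ℤ) 1 < -1 ∧ (1 : ℤ) ≤ max (-2 : ℤ) 1 := by
  norm_num

/-! ## §3 R29 LAW B re-read (hosted specimens `S-(a,a+1,2a+1)`, Z^st-first order, all `a`) -/

/-- ADAPTED COORDINATES at stage `St1` (chart `x` of `(pt)@P₀`: `y = y₁x`, `z = z₁x`, `E_P = {x = 0}`, host `St Q′ = V(xy₁ − z₁)`, nose
`Z^st = (t^a, t, t^(a+1))`, line `ℓ = V(x, z₁)`): put `x = X + y₁^a`, `z₁ = V + (X + y₁^a)·y₁`.  Then `St Q′ = V(V)` (first identity), `Z^st = V(X,V)`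
(second), `ℓ = V(X + y₁^a, V)` (third); in chart `u` of `Bl_{Z^st}` (`V = V₁X`, exceptional `X`) the strict transform of the host is `St Q″ = V(V₁)`
(fourth: `V` vanishes to order exactly one along `Z^st`) and `St E_P = V(X + y₁^a)` (`E_P ⊅ Z^st`), so `ℓ^st = cl(ℓ ∖ Z^st) = V(X + y₁^a, V₁) =
St E_P ∩ St Q″`, a complete intersection of two hypersurfaces whose Jacobian has the unit minor `∂(X + y₁^a, V₁)/∂(X, V₁) = 1` (fifth):
TRANSVERSAL along all of `ℓ^st`, for every `a`. -/
theorem adapted (a : ℕ) (X y₁ V V₁ t : ℚ) :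
    (X + y₁^a) * y₁ - (V + (X + y₁^a) * y₁) = -V ∧
    (t^a - t^a = 0 ∧ t^(a+1) - (t^a - t^a + t^a) * t = 0) ∧
    ((0:ℚ) - y₁^a + y₁^a = 0 ∧ (0:ℚ) - (0 - y₁^a + y₁^a) * y₁ = 0) ∧
    V₁ * X = X^1 * V₁ ∧
    ((1:ℚ) * 1 - 0 * 0 = 1) := by
  refine ⟨by ring, ⟨by ring, by ring⟩, ⟨by ring, by ring⟩, by ring, by norm_num⟩

/-- THE PAIR OF `ℓ^st` (memo §5; R30 §4(ℓ) for the inputs): `ℓ ⊂ St Q′ = Bl_P Q` is the exceptional curve, `(ℓ²)_{St Q′} = −1`, unchanged by the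
`Z^st` round (`Z^st` is Cartier on `St Q′`, `St Q″ ≅ St Q′`); `ℓ ⊂ E_P ≅ ℙ²` is a line, `(ℓ²)_{E_P} = 1`, and `Z^st` meets `E_P` in the curvilinear
scheme of length `a` on `ℓ` at `z₀` (contact `(ℓ·Z^st)_{St Q′} = a`, kit B1x″ of R30), so `(ℓ^st)²_{St E_P} = 1 − a`.  Pair `(−1, 1−a)`, `deg N = −a`,
`h¹(N) = h¹(𝒪(1−a)) = a − 2` (R29 LAW B, unchanged): FREE-illegal iff `a ≥ 3`; host-legal for every `a` (host `St Q″`, `H¹(𝒪(−1)) = 0`). -/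
theorem ellst_pair (a : ℤ) :
    (-1 : ℤ) + (1 - a) = -a ∧ (1 - a ≤ -2 ↔ 3 ≤ a) ∧ (a - 1) - 1 = a - 2 ∧ (-1 : ℤ) ≤ max (-1) (1 - a) ∧ (3 ≤ a → min (-1 : ℤ) (1 - a) < -1) := by
  refine ⟨by ring, by omega, by ring, ?_, ?_⟩
  · simp only [le_max_iff]; left; norm_num
  · intro h; simp only [min_lt_iff]; right; omega

/-- R30's contrast (ℓ-FIRST order): `ℓ ⊂ F₂` BEFORE the `Z^st` round has pair `((ℓ²)_{St Q′}, (ℓ²)_{E_P}) = (−1, 1)`: FREE-legal. The two orders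
differ exactly in the one letter `ℓ` vs `ℓ^st`. -/
theorem ell_first_pair : (-1 : ℤ) ≤ min (-1) 1 ∧ (1 : ℤ) ≤ max (-1) 1 := by norm_num

end Summit.ResolutionOfSingularities.ResolutionOfSingularities.Cruxes.EquisingularLiftNatThree.GmNosesHostLawR31
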